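/-
Copyright (c) 2026. All rights reserved.
Released under Apache 2.0 license as described in the file LICENSE.
Authors: abc-iut cell, seat abc-iut-L6-t6 (proof-only tool over abc-iut-found's Definitions 1.1–1.2 API).
-/
import Literature.AlgebraicGeometry.Frobenioids.CoAngular
import HarnessLib

/-!
# Frobenioids I, Definition 1.2 under a change of the underlying category by an equivalence

Mochizuki, *The geometry of Frobenioids I: the general theory*, Kyushu J. Math. **62** (2008),
§1, Definitions 1.1 (iv), 1.2 (kurims text pp. 19–24) [cite: MochizukiFrdI2008, Def. 1.2 p.21].
A pre-Frobenioid structure on a category `C` is a functor `F : C → F_Φ`; the text constantly passes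
to "any category equivalent to" a given (model) Frobenioid (e.g. [FrdI] Thm. 5.2 (iv), [IUTchI]
Example 5.1 (iii) "`†ℱ^⊛` := any category equivalent to `ℱ^⊛(†𝒟^⊚)`"), the structure being the
composite `C' ⥲ C → F_Φ`. This file records, for a functor `G : C' ⥤ C` and the induced structure
`G ⋙ F` on `C'`, that the notions of Definition 1.2 which only read `Base`, `Div`, `deg_Fr` are
LITERALLY the corresponding notions of the image arrow (`Iff.rfl`), and proves, for an EQUIVALENCE
`e : C' ≌ C`, that the genuinely categorical notions — isomorphisms, co-angular / LB-invertible /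
Frobenius-type arrows, pull-back morphisms, Frobenius-trivial and isotropic objects, isotropic hulls —
correspond as well — the latter in the companion `PreFrobenioidEquivalenceTransport.lean`; here: the
`Iff.rfl` lemmas for an arbitrary `G`, and the stability of the Definition 1.2 notions under
composition with isomorphisms of `C` that the transport uses (invariance of isotropy / isotropic hulls /
Frobenius-triviality under isomorphism of OBJECTS is already in the tree: `IsIsotropic.of_iso`,
`IsIsotropicHull.comp_iso` (abc-iut-L1-t1, `IsometricPreSteps.lean`), `IsFrobeniusTrivial.of_iso`
(abc-iut-found, `IsotropicFrobeniusTrivial.lean`)).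
`FrobenioidEquivalence.lean` then assembles Definition 1.1 (iv) and Definition 1.3 (pre-Frobenioids,
Frobenioids) along `e`. Everything here "follows formally from the definitions"; no statement of the
paper is strengthened and no new notion is defined.
-/

namespace Literature.AlgebraicGeometry.Frobenioids

open CategoryTheory Opposite

universe w v v' v'' u u' u''

namespace PreFrobenioid

variable {D : Type u} [Category.{v} D] {Φ : Dᵒᵖ ⥤ CommMonCat.{w}}
  {C : Type u'} [Category.{v'} C] {C' : Type u''} [Category.{v''} C']
  (F : C ⥤ ElemFrobenioid Φ)

/-! ### The notions that only read `Base`, `Div`, `deg_Fr`: literally the same for `G ⋙ F` -/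

section AnyFunctor

variable (G : C' ⥤ C)

/-- `Base_{G ⋙ F}(A) = Base_F(G A)`. [cite: MochizukiFrdI2008, Def. 1.1(iv) p.19] -/
theorem baseObj_precomp (A : C') : baseObj (G ⋙ F) A = baseObj F (G.obj A) := rfl

/-- `Base_{G ⋙ F}(φ) = Base_F(G φ)`. [cite: MochizukiFrdI2008, Def. 1.1(iv) p.19] -/
theorem base_precomp {A B : C'} (φ : A ⟶ B) : Base (G ⋙ F) φ = Base F (G.map φ) := rfl

/-- `Div_{G ⋙ F}(φ) = Div_F(G φ)`. [cite: MochizukiFrdI2008, Def. 1.1(iv) p.19] -/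
theorem div_precomp {A B : C'} (φ : A ⟶ B) : Div (G ⋙ F) φ = Div F (G.map φ) := rfl

/-- `deg_Fr,{G ⋙ F}(φ) = deg_Fr,F(G φ)`. [cite: MochizukiFrdI2008, Def. 1.1(iv) p.19] -/
theorem degFr_precomp {A B : C'} (φ : A ⟶ B) : degFr (G ⋙ F) φ = degFr F (G.map φ) := rfl

/-- Linear for `G ⋙ F` iff the image is linear for `F`. [cite: MochizukiFrdI2008, Def. 1.2(i) p.21] -/
theorem isLinear_precomp_iff {A B : C'} (φ : A ⟶ B) :
    IsLinear (G ⋙ F) φ ↔ IsLinear F (G.map φ) := Iff.rfl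

/-- Isometry for `G ⋙ F` iff the image is an isometry for `F`. [cite: MochizukiFrdI2008, Def. 1.2(i) p.21] -/
theorem isIsometry_precomp_iff {A B : C'} (φ : A ⟶ B) :
    IsIsometry (G ⋙ F) φ ↔ IsIsometry F (G.map φ) := Iff.rfl

/-- Metric equivalence for `G ⋙ F` iff for the images. [cite: MochizukiFrdI2008, Def. 1.2(i) p.21] -/
theorem metricallyEquivalent_precomp_iff {A B : C'} (φ ψ : A ⟶ B) :
    MetricallyEquivalent (G ⋙ F) φ ψ ↔ MetricallyEquivalent F (G.map φ) (G.map ψ) := Iff.rfl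

/-- Base-isomorphism for `G ⋙ F` iff the image is one for `F`. [cite: MochizukiFrdI2008, Def. 1.2(ii) p.21] -/
theorem isBaseIso_precomp_iff {A B : C'} (φ : A ⟶ B) :
    IsBaseIso (G ⋙ F) φ ↔ IsBaseIso F (G.map φ) := Iff.rfl

/-- Base-FSM-morphism for `G ⋙ F` iff the image is one for `F`. [cite: MochizukiFrdI2008, Def. 1.2(ii) p.21] -/
theorem isBaseFSM_precomp_iff {A B : C'} (φ : A ⟶ B) :
    IsBaseFSM (G ⋙ F) φ ↔ IsBaseFSM F (G.map φ) := Iff.rfl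

/-- Base-isomorphic objects for `G ⋙ F` iff the images are. [cite: MochizukiFrdI2008, Def. 1.2(ii) p.21] -/
theorem baseIsomorphic_precomp_iff (A B : C') :
    BaseIsomorphic (G ⋙ F) A B ↔ BaseIsomorphic F (G.obj A) (G.obj B) := Iff.rfl

/-- Base-equivalence for `G ⋙ F` iff for the images. [cite: MochizukiFrdI2008, Def. 1.2(ii) p.22] -/
theorem baseEquivalent_precomp_iff {A B : C'} (φ ψ : A ⟶ B) :
    BaseEquivalent (G ⋙ F) φ ψ ↔ BaseEquivalent F (G.map φ) (G.map ψ) := Iff.rfl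

/-- `Div`-equivalence for `G ⋙ F` iff for the images. [cite: MochizukiFrdI2008, Def. 1.2(ii) p.22] -/
theorem divEquivalent_precomp_iff {A B : C'} (φ ψ : A ⟶ B) :
    DivEquivalent (G ⋙ F) φ ψ ↔ DivEquivalent F (G.map φ) (G.map ψ) := Iff.rfl

/-- Base-identity endomorphism for `G ⋙ F` iff the image is one. [cite: MochizukiFrdI2008, Def. 1.2(ii) p.22] -/
theorem isBaseIdentity_precomp_iff {A : C'} (φ : A ⟶ A) :
    IsBaseIdentity (G ⋙ F) φ ↔ IsBaseIdentity F (G.map φ) := Iff.rfl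

/-- `Div`-identity endomorphism for `G ⋙ F` iff the image is one. [cite: MochizukiFrdI2008, Def. 1.2(ii) p.22] -/
theorem isDivIdentity_precomp_iff {A : C'} (φ : A ⟶ A) :
    IsDivIdentity (G ⋙ F) φ ↔ IsDivIdentity F (G.map φ) := Iff.rfl

/-- Pre-step for `G ⋙ F` iff the image is a pre-step for `F`. [cite: MochizukiFrdI2008, Def. 1.2(iii) p.22] -/
theorem isPreStep_precomp_iff {A B : C'} (φ : A ⟶ B) :
    IsPreStep (G ⋙ F) φ ↔ IsPreStep F (G.map φ) := Iff.rfl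

/-- Primary pre-step for `G ⋙ F` iff the image is one for `F`. [cite: MochizukiFrdI2008, Def. 1.2(iii) p.22] -/
theorem isPrimaryPreStep_precomp_iff {A B : C'} (φ : A ⟶ B) :
    IsPrimaryPreStep (G ⋙ F) φ ↔ IsPrimaryPreStep F (G.map φ) := Iff.rfl

/-- Group-like object for `G ⋙ F` iff the image is group-like for `F`. [cite: MochizukiFrdI2008, Def. 1.2(iv) p.23] -/
theorem isGroupLikeObj_precomp_iff (A : C') :
    IsGroupLikeObj (G ⋙ F) A ↔ IsGroupLikeObj F (G.obj A) := Iff.rfl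

/-- The invariant `(ψ^*)⁻¹ Div(ψ)` of a base-isomorphism is the same for `G ⋙ F` and for the image
under `F`. [cite: MochizukiFrdI2008, Def. 1.3(iii) p.25] -/
theorem invDiv_precomp {B A : C'} (ψ : B ⟶ A) (h : IsBaseIso (G ⋙ F) ψ) :
    invDiv (G ⋙ F) ψ h = invDiv F (G.map ψ) h := rfl

end AnyFunctor

/-! ### Stability of the Definition 1.2 notions under composition with isomorphisms of `C` -/

section IsoStability

variable {F}

/-- Precomposing with an isomorphism preserves co-angularity (pure bookkeeping on factorisations).
[cite: MochizukiFrdI2008, Def. 1.2(iii) p.22] -/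
theorem IsCoAngular.iso_comp {A' A B : C} (c : A' ⟶ A) [IsIso c] {φ : A ⟶ B}
    (hφ : IsCoAngular F φ) : IsCoAngular F (c ≫ φ) := by
  intro X Y γ β α h hα hβ₁ hβ₂ hbi
  refine hφ (inv c ≫ γ) β α ?_ hα hβ₁ hβ₂ ?_
  · rw [Category.assoc, h, IsIso.inv_hom_id_assoc]
  · rcases hbi with hα' | hγ
    · exact Or.inl hα'
    · exact Or.inr (IsBaseIso.comp F (isBaseIso_of_isIso F (inv c)) hγ)

/-- Postcomposing with an isomorphism preserves co-angularity. [cite: MochizukiFrdI2008, Def. 1.2(iii) p.22] -/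
theorem IsCoAngular.comp_iso {A B B' : C} {φ : A ⟶ B} (hφ : IsCoAngular F φ) (c : B ⟶ B')
    [IsIso c] : IsCoAngular F (φ ≫ c) := by
  intro X Y γ β α h hα hβ₁ hβ₂ hbi
  refine hφ γ β (α ≫ inv c) ?_ (IsLinear.comp F hα (isLinear_of_isIso F (inv c))) hβ₁ hβ₂ ?_
  · rw [← Category.assoc β, ← Category.assoc γ, h, Category.assoc, IsIso.hom_inv_id,
      Category.comp_id]
  · rcases hbi with hα' | hγ
    · exact Or.inl (IsBaseIso.comp F hα' (isBaseIso_of_isIso F (inv c)))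
    · exact Or.inr hγ

/-- Cancelling an isomorphism on the left: `c ≫ φ` co-angular implies `φ` co-angular.
[cite: MochizukiFrdI2008, Def. 1.2(iii) p.22] -/
theorem IsCoAngular.of_iso_comp {A' A B : C} (c : A' ⟶ A) [IsIso c] {φ : A ⟶ B}
    (h : IsCoAngular F (c ≫ φ)) : IsCoAngular F φ := by
  have h' := h.iso_comp (inv c)
  rwa [IsIso.inv_hom_id_assoc] at h'

/-- Cancelling an isomorphism on the right. [cite: MochizukiFrdI2008, Def. 1.2(iii) p.22] -/
theorem IsCoAngular.of_comp_iso {A B B' : C} {φ : A ⟶ B} (c : B ⟶ B') [IsIso c]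
    (h : IsCoAngular F (φ ≫ c)) : IsCoAngular F φ := by
  have h' := h.comp_iso (inv c)
  rwa [Category.assoc, IsIso.hom_inv_id, Category.comp_id] at h'

/-- In a pre-Frobenioid, precomposing with an isomorphism preserves "of Frobenius type".
[cite: MochizukiFrdI2008, Def. 1.2(iii) p.22] -/
theorem IsFrobeniusType.iso_comp (hP : IsPreFrobenioid Φ F) {A' A B : C} (c : A' ⟶ A) [IsIso c]
    {φ : A ⟶ B} (hφ : IsFrobeniusType F φ) : IsFrobeniusType F (c ≫ φ) :=
  ⟨⟨hφ.1.1.iso_comp c, IsIsometry.comp F (isIsometry_of_isIso F hP c) hφ.1.2⟩,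
    IsBaseIso.comp F (isBaseIso_of_isIso F c) hφ.2⟩

/-- In a pre-Frobenioid, postcomposing with an isomorphism preserves "of Frobenius type".
[cite: MochizukiFrdI2008, Def. 1.2(iii) p.22] -/
theorem IsFrobeniusType.comp_iso (hP : IsPreFrobenioid Φ F) {A B B' : C} {φ : A ⟶ B}
    (hφ : IsFrobeniusType F φ) (c : B ⟶ B') [IsIso c] : IsFrobeniusType F (φ ≫ c) :=
  ⟨⟨hφ.1.1.comp_iso c, IsIsometry.comp F hφ.1.2 (isIsometry_of_isIso F hP c)⟩,
    IsBaseIso.comp F hφ.2 (isBaseIso_of_isIso F c)⟩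

/-- In a pre-Frobenioid, precomposing with an isomorphism preserves co-angular pre-steps.
[cite: MochizukiFrdI2008, Def. 1.3(iii) p.25] -/
theorem IsCoAngularPreStep.iso_comp {A' A B : C} (c : A' ⟶ A) [IsIso c]
    {φ : A ⟶ B} (hφ : IsCoAngularPreStep F φ) : IsCoAngularPreStep F (c ≫ φ) :=
  ⟨hφ.1.iso_comp c, IsPreStep.comp F (isPreStep_of_isIso F c) hφ.2⟩

/-- Postcomposing with an isomorphism preserves co-angular pre-steps. [cite: MochizukiFrdI2008, Def. 1.3(iii) p.25] -/
theorem IsCoAngularPreStep.comp_iso {A B B' : C} {φ : A ⟶ B} (hφ : IsCoAngularPreStep F φ)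
    (c : B ⟶ B') [IsIso c] : IsCoAngularPreStep F (φ ≫ c) :=
  ⟨hφ.1.comp_iso c, IsPreStep.comp F hφ.2 (isPreStep_of_isIso F c)⟩

/-- In a pre-Frobenioid the zero divisor is unchanged by postcomposition with an isomorphism:
`Div(c ∘ φ) = Base(φ)^* Div(c) + deg_Fr(c)·Div(φ) = Div(φ)`. [cite: MochizukiFrdI2008, Rem. 1.1.1 p.20] -/
theorem div_comp_iso (hP : IsPreFrobenioid Φ F) {A B B' : C} (φ : A ⟶ B) (c : B ⟶ B') [IsIso c] :
    Div F (φ ≫ c) = Div F φ := by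
  rw [div_comp, show Div F c = 1 from isIsometry_of_isIso F hP c, map_one, one_mul,
    show degFr F c = 1 from isLinear_of_isIso F c, PNat.one_coe, pow_one]

/-- In a pre-Frobenioid `deg_Fr` is unchanged by postcomposition with an isomorphism.
[cite: MochizukiFrdI2008, Rem. 1.1.1 p.20] -/
theorem degFr_comp_iso {A B B' : C} (φ : A ⟶ B) (c : B ⟶ B') [IsIso c] :
    degFr F (φ ≫ c) = degFr F φ := by
  rw [degFr_comp, show degFr F c = 1 from isLinear_of_isIso F c, mul_one]

/-- In a pre-Frobenioid `deg_Fr` is unchanged by precomposition with an isomorphism.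
[cite: MochizukiFrdI2008, Rem. 1.1.1 p.20] -/
theorem degFr_iso_comp {A' A B : C} (c : A' ⟶ A) [IsIso c] (φ : A ⟶ B) :
    degFr F (c ≫ φ) = degFr F φ := by
  rw [degFr_comp, show degFr F c = 1 from isLinear_of_isIso F c, one_mul]

/-- In a pre-Frobenioid the invariant `(ψ^*)⁻¹ Div(ψ)` of a base-isomorphism `ψ` is unchanged by
precomposing `ψ` with an isomorphism. [cite: MochizukiFrdI2008, Def. 1.3(iii) p.25] -/
theorem invDiv_iso_comp (hP : IsPreFrobenioid Φ F) {B' B A : C} (c : B' ⟶ B) [IsIso c] (ψ : B ⟶ A)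
    (h : IsBaseIso F ψ) (h' : IsBaseIso F (c ≫ ψ)) :
    invDiv F (c ≫ ψ) h' = invDiv F ψ h := by
  haveI : IsIso (Base F ψ) := h
  haveI : IsIso (Base F (c ≫ ψ)) := h'
  haveI : IsIso (Base F c) := isBaseIso_of_isIso F c
  unfold invDiv
  have hdiv : Div F (c ≫ ψ) = pull Φ (Base F c) (Div F ψ) := by
    rw [div_comp, show Div F c = 1 from isIsometry_of_isIso F hP c, one_pow, mul_one]
  have hinv : inv (Base F (c ≫ ψ)) = inv (Base F ψ) ≫ inv (Base F c) := by
    apply IsIso.inv_eq_of_hom_inv_id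
    rw [base_comp, Category.assoc, IsIso.hom_inv_id_assoc, IsIso.hom_inv_id]
  rw [hdiv, hinv, pull_comp, ← pull_comp Φ (inv (Base F c)) (Base F c) (Div F ψ), IsIso.inv_hom_id,
    pull_id]

end IsoStability


end PreFrobenioid

end Literature.AlgebraicGeometry.Frobenioids
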